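import Summits.QuantumFields.GaugeBoot.DiagonalRPTorusHexChecker
import HarnessLib

/-!
# The decision-tree certificate with a PARAMETRIC rest test (gauge-boot, L3 `d = 3` uniform window, odd leg, brick 2)

HONEST FRAMING (cell `pub-gaugeboot`, page 1 of every file): the venture produces certified bounds
on lattice expectations at stated coupling, gauge group, dimension and torus size; NOT a mass gap,
NOT a continuum limit, NOT a string tension; NOT Yang–Mills-summit-bearing (barriers
`FixedCouplingUltralocality`, `PerturbativeInvisibility`). This module is bookkeeping for a
structural NEGATIVE result (coupling windows UNIFORM in the torus size for the failure of diagonal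
reflection positivity on `(ℤ/L)^3`); it discharges nothing by itself.

## Content

`DiagonalRPTorusHexChecker` hard-wires the local rest test of EVEN tori (`lrest`) and the region
`restPlaqs 0 1 c`, `L = 2c`. Here the same checker and the same soundness proof are given for an
ARBITRARY Boolean local test `rt` over-approximating an arbitrary region `V` of torus plaquettes on
the box (`hrt : InBox (B+2) p.1 → plaq y p ∈ V → rt p`):

* `unknownBR`, `pessXR`, `checkR rt E₁ E₂ T n B` — the parametric checker (certificate format,
  `pick`, `pruneOrder`, … from brick 2 of the even leg);
* ★★ **`checkR_sound`**, **`eq_tube_or_hasForestSplit_of_checkR`** — every `Q ⊆ V` with `#Q ≤ n`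
  is the chart image of `T` or has a forest split.

The odd leg instantiates it with `rt = lrestOdd`, `V = restPlaqs 0 1 (c+1)`, `L = 2c+1`
(`DiagonalRPTorusHexLocalRestOdd`). Elementary bookkeeping; no named fact.
-/

open Finset Function

namespace Summit.QuantumFields.GaugeBoot

open Literature.MathematicalPhysics.QuantumFieldTheory

namespace DiagRPHex

open DiagRPTube DiagRPUnif

/-! ## The parametric checker -/

/-- Some plaquette through `ℓ` passing the local test `rt` is undecided. -/
def unknownBR (rt : LPlaq → Bool) (IN OUT : List LPlaq) (ℓ : LEdge) : Bool :=
  (lstar ℓ).any fun p => rt p && !(IN.elem p) && !(OUT.elem p)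

/-- The pessimistic interface, parametric rest test. -/
def pessXR (rt : LPlaq → Bool) (Es Eo : List LEdge) (n : ℕ) (IN OUT S R : List LPlaq) : List LEdge :=
  (Es ++ llinksOf S).filter fun ℓ =>
    Eo.elem ℓ || (llinksOf R).elem ℓ || (!(decide (n ≤ IN.length)) && unknownBR rt IN OUT ℓ)

/-- THE PARAMETRIC CHECKER. -/
def checkR (rt : LPlaq → Bool) (E₁ E₂ : List LEdge) (T : List LPlaq) (n B : ℕ) :
    Cert → List LPlaq → List LPlaq → Bool
  | .br p cin cout, IN, OUT => inBoxB B p.1 && !(IN.elem p) && !(OUT.elem p) &&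
      checkR rt E₁ E₂ T n B cin (p :: IN) OUT && checkR rt E₁ E₂ T n B cout IN (p :: OUT)
  | .tube, IN, _ => decide (IN.length = n) && IN.all (fun p => T.elem p) && T.all (fun p => IN.elem p)
  | .sp side idx, IN, OUT => decide (n < IN.length) ||
      (let SR := pick idx IN 0
       let X := pessXR rt (if side then E₁ else E₂) (if side then E₂ else E₁) n IN OUT SR.1 SR.2
       let lo := pruneOrder X.length X
       lIsLeafOrder lo && X.all fun ℓ => lo.elem ℓ)

/-! ## Soundness -/

section Sound

variable {L : ℕ} (y : Site 3 L) (rt : LPlaq → Bool) (E₁ E₂ : List LEdge) (T : List LPlaq)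
  (n B : ℕ) (V : Finset (Plaquette 3 L))

variable {y rt E₁ E₂ T n B V}

/-- ★ **The interface of a split leaf lies in the chart image of the pessimistic interface.**
(`S`, `R` the picked / unpicked members of `IN`; every hypothesis of `checkR_sound`.) -/
theorem interface_subset_pessXR (hBL : 2 * (B + 2) < L)
    (hrt : ∀ p : LPlaq, InBox (B + 2) p.1 → plaq y p ∈ V → rt p = true) {Es Eo : List LEdge}
    (hEs : ∀ e ∈ Es, InBox B e.1) (hEo : ∀ e ∈ Eo, InBox B e.1) {IN OUT S R : List LPlaq}
    (hIN : ∀ p ∈ IN, InBox B p.1) (hnd : IN.Nodup) (hS : ∀ p ∈ S, p ∈ IN)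
    (hSR : ∀ p ∈ IN, p ∈ S ∨ p ∈ R) {Q : Finset (Plaquette 3 L)}
    (hQ : Q ⊆ V) (hQn : Q.card ≤ n) (hin : ∀ p ∈ IN, plaq y p ∈ Q)
    (hout : ∀ p ∈ OUT, plaq y p ∉ Q) {e : Edge 3 L}
    (he : e ∈ (Et y Es ∪ linksOf (Pt y S)) ∩ (Et y Eo ∪ linksOf (Q \ Pt y S))) :
    ∃ ℓ ∈ pessXR rt Es Eo n IN OUT S R, edge y ℓ = e := by
  obtain ⟨he1, he2⟩ := mem_inter.1 he
  rw [mem_union] at he1 he2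
  -- the link is charted from the candidate list
  obtain ⟨ℓ, hℓc, rfl⟩ : ∃ ℓ ∈ Es ++ llinksOf S, edge y ℓ = e := by
    rcases he1 with h | h
    · obtain ⟨ℓ, hℓ, rfl⟩ := mem_Et.1 h
      exact ⟨ℓ, List.mem_append_left _ hℓ, rfl⟩
    · obtain ⟨q, hq, hqe⟩ := mem_linksOf.1 h
      obtain ⟨p, hp, rfl⟩ := mem_Pt.1 hq
      obtain ⟨a, ha⟩ := hqe
      rw [link_plaq] at ha
      exact ⟨llink p a, List.mem_append_right _ (mem_llinksOf.2 ⟨p, hp, mem_llinks.2 ⟨a, rfl⟩⟩), ha⟩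
  have hℓbox : InBox (B + 1) ℓ.1 := by
    rcases List.mem_append.1 hℓc with h | h
    · exact (hEs ℓ h).mono (Nat.le_succ B)
    · obtain ⟨p, hp, hℓp⟩ := mem_llinksOf.1 h
      obtain ⟨a, rfl⟩ := mem_llinks.1 hℓp
      exact inBox_llink (hIN p (hS p hp)) a
  refine ⟨ℓ, List.mem_filter.2 ⟨hℓc, ?_⟩, rfl⟩
  simp only [Bool.or_eq_true, List.elem_iff, Bool.and_eq_true, Bool.not_eq_true',
    decide_eq_false_iff_not, not_le]
  rcases he2 with h | h
  · -- on the other hexagon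
    obtain ⟨ℓ', hℓ', hℓ'e⟩ := mem_Et.1 h
    have : ℓ' = ℓ := edge_injOn y (by omega) ((hEo ℓ' hℓ').mono (Nat.le_succ B)) hℓbox hℓ'e
    subst this
    exact Or.inl (Or.inl hℓ')
  · -- through a plaquette of `Q` off the picked side
    obtain ⟨q, hq, hqe⟩ := mem_linksOf.1 h
    rw [mem_sdiff] at hq
    obtain ⟨hqQ, hqS⟩ := hq
    obtain ⟨p', hp'star, rfl⟩ := exists_mem_lstar_of_hasLink y hqe
    have hp'box : InBox (B + 2) p'.1 := inBox_of_mem_lstar hℓbox hp'star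
    have hp'rest : rt p' = true := hrt p' hp'box (hQ hqQ)
    have hp'S : p' ∉ S := fun h => hqS (mem_Pt.2 ⟨p', h, rfl⟩)
    by_cases hp'IN : p' ∈ IN
    · -- a known member off the picked side
      have hp'R : p' ∈ R := (hSR p' hp'IN).resolve_left hp'S
      exact Or.inl (Or.inr (mem_llinksOf.2 ⟨p', hp'R, mem_llinks_of_mem_lstar hp'star⟩))
    · -- an undecided plaquette: the pessimistic clause
      have hp'OUT : p' ∉ OUT := fun h => hout p' h hqQ
      refine Or.inr ⟨?_, ?_⟩
      · -- not full: otherwise `Q = Pt IN` and `p' ∈ IN`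
        by_contra hfull
        rw [not_lt] at hfull
        have hQeq := eq_Pt_of_full (by omega : 2 * B < L) hIN hnd hin (hQn.trans hfull)
        rw [hQeq] at hqQ
        obtain ⟨p'', hp'', he''⟩ := mem_Pt.1 hqQ
        have : p'' = p' := plaq_injOn y hBL ((hIN p'' hp'').mono (by omega)) hp'box he''
        exact hp'IN (this ▸ hp'')
      · unfold unknownBR
        rw [List.any_eq_true]
        refine ⟨p', hp'star, ?_⟩
        simp [hp'rest, hp'IN, hp'OUT]

/-- ★★ **SOUNDNESS OF THE CHECKER.** -/
theorem checkR_sound (hBL : 2 * (B + 2) < L)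
    (hrt : ∀ p : LPlaq, InBox (B + 2) p.1 → plaq y p ∈ V → rt p = true)
    (hE₁ : ∀ e ∈ E₁, InBox B e.1) (hE₂ : ∀ e ∈ E₂, InBox B e.1) :
    ∀ (t : Cert) (IN OUT : List LPlaq), (∀ p ∈ IN, InBox B p.1) → IN.Nodup →
      checkR rt E₁ E₂ T n B t IN OUT = true →
      ∀ Q : Finset (Plaquette 3 L), Q ⊆ V → Q.card ≤ n →
        (∀ p ∈ IN, plaq y p ∈ Q) → (∀ p ∈ OUT, plaq y p ∉ Q) →
        Q = Pt y T ∨ HasForestSplit (Et y E₁) (Et y E₂) Q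
  | .br p cin cout, IN, OUT, hIN, hnd, hch, Q, hQ, hQn, hin, hout => by
    simp only [checkR, Bool.and_eq_true, Bool.not_eq_true', List.elem_eq_mem, decide_eq_false_iff_not] at hch
    obtain ⟨⟨⟨⟨hbox, hpIN⟩, -⟩, hcin⟩, hcout⟩ := hch
    have hpbox := inBox_of_inBoxB hbox
    by_cases hpQ : plaq y p ∈ Q
    · refine checkR_sound hBL hrt hE₁ hE₂ cin (p :: IN) OUT ?_ (List.nodup_cons.2 ⟨hpIN, hnd⟩) hcin
        Q hQ hQn ?_ hout
      · intro q hq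
        rcases List.mem_cons.1 hq with rfl | hq; exacts [hpbox, hIN q hq]
      · intro q hq
        rcases List.mem_cons.1 hq with rfl | hq; exacts [hpQ, hin q hq]
    · refine checkR_sound hBL hrt hE₁ hE₂ cout IN (p :: OUT) hIN hnd hcout Q hQ hQn hin ?_
      intro q hq
      rcases List.mem_cons.1 hq with rfl | hq; exacts [hpQ, hout q hq]
  | .tube, IN, OUT, hIN, hnd, hch, Q, hQ, hQn, hin, hout => by
    have hBL' : 2 * B < L := by omega
    simp only [checkR, Bool.and_eq_true, decide_eq_true_eq, List.all_eq_true, List.elem_iff] at hch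
    obtain ⟨⟨hlen, hIT⟩, hTI⟩ := hch
    left
    have hQeq := eq_Pt_of_full hBL' hIN hnd hin (hQn.trans hlen.symm.le)
    rw [hQeq]
    ext q
    simp only [mem_Pt]
    exact ⟨fun ⟨p, hp, he⟩ => ⟨p, hIT p hp, he⟩, fun ⟨p, hp, he⟩ => ⟨p, hTI p hp, he⟩⟩
  | .sp side idx, IN, OUT, hIN, hnd, hch, Q, hQ, hQn, hin, hout => by
    have hBL' : 2 * B < L := by omega
    simp only [checkR, Bool.or_eq_true, decide_eq_true_eq, Bool.and_eq_true, List.all_eq_true,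
      List.elem_iff] at hch
    rcases hch with hlt | ⟨hlo, hall⟩
    · -- more known members than `Q` has room for
      have := card_Pt (y := y) hBL' hIN hnd
      have := Finset.card_le_card (show Pt y IN ⊆ Q from fun q hq => by
        obtain ⟨p, hp, rfl⟩ := mem_Pt.1 hq; exact hin p hp)
      omega
    · right
      set S := (pick idx IN 0).1 with hSdef
      set R := (pick idx IN 0).2 with hRdef
      have hS : ∀ p ∈ S, p ∈ IN := fun p hp => mem_of_mem_pick_fst idx IN 0 hp
      have hSR : ∀ p ∈ IN, p ∈ S ∨ p ∈ R := fun p hp => mem_pick_or idx IN 0 hp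
      have hPS : Pt y S ⊆ Q := fun q hq => by
        obtain ⟨p, hp, rfl⟩ := mem_Pt.1 hq; exact hin p (hS p hp)
      -- the two sides, uniformly
      set Es := (if side then E₁ else E₂) with hEs
      set Eo := (if side then E₂ else E₁) with hEo
      have hEs' : ∀ e ∈ Es, InBox B e.1 := fun e he => by
        rw [hEs] at he; split_ifs at he; exacts [hE₁ e he, hE₂ e he]
      have hEo' : ∀ e ∈ Eo, InBox B e.1 := fun e he => by
        rw [hEo] at he; split_ifs at he; exacts [hE₂ e he, hE₁ e he]
      set X := pessXR rt Es Eo n IN OUT S R with hX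
      set lo := pruneOrder X.length X with hlodef
      have hlobox : ∀ ℓ ∈ lo, InBox (B + 1) ℓ.1 := by
        intro ℓ hℓ
        have hℓX : ℓ ∈ X := mem_of_mem_pruneOrder _ _ hℓ
        have hℓc := (List.mem_filter.1 hℓX).1
        rcases List.mem_append.1 hℓc with h | h
        · exact (hEs' ℓ h).mono (Nat.le_succ B)
        · obtain ⟨p, hp, hℓp⟩ := mem_llinksOf.1 h
          obtain ⟨a, rfl⟩ := mem_llinks.1 hℓp
          exact inBox_llink (hIN p (hS p hp)) a
      have hleaf : TreeGauge.IsLeafOrder (lo.map (edge y)) :=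
        isLeafOrder_map_edge y (by omega) lo hlobox hlo
      have hsubset : (Et y Es ∪ linksOf (Pt y S)) ∩ (Et y Eo ∪ linksOf (Q \ Pt y S)) ⊆
          (lo.map (edge y)).toFinset := by
        intro e he
        obtain ⟨ℓ, hℓX, rfl⟩ := interface_subset_pessXR hBL hrt hEs' hEo' hIN hnd hS hSR hQ hQn
          hin hout he
        rw [List.mem_toFinset]
        exact List.mem_map.2 ⟨ℓ, hall ℓ hℓX, rfl⟩
      cases side
      · -- `S` on the `E₂` side: `Q₁ = Q \ Pt S`, `Q₂ = Pt S`
        refine ⟨Q \ Pt y S, Pt y S, ?_, disjoint_sdiff_self_left, lo.map (edge y), hleaf, ?_⟩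
        · rw [sdiff_union_of_subset hPS]
        · rw [inter_comm]
          simpa [hEs, hEo] using hsubset
      · -- `S` on the `E₁` side: `Q₁ = Pt S`, `Q₂ = Q \ Pt S`
        refine ⟨Pt y S, Q \ Pt y S, ?_, disjoint_sdiff_self_right, lo.map (edge y), hleaf, ?_⟩
        · rw [union_sdiff_of_subset hPS]
        · simpa [hEs, hEo] using hsubset

/-- ★★ **SOUNDNESS, closed form**: a certificate checked from the empty state classifies every
small rest cluster. -/
theorem eq_tube_or_hasForestSplit_of_checkR (hBL : 2 * (B + 2) < L)
    (hrt : ∀ p : LPlaq, InBox (B + 2) p.1 → plaq y p ∈ V → rt p = true)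
    (hE₁ : ∀ e ∈ E₁, InBox B e.1) (hE₂ : ∀ e ∈ E₂, InBox B e.1) {t : Cert}
    (ht : checkR rt E₁ E₂ T n B t [] [] = true) {Q : Finset (Plaquette 3 L)}
    (hQ : Q ⊆ V) (hQn : Q.card ≤ n) :
    Q = Pt y T ∨ HasForestSplit (Et y E₁) (Et y E₂) Q :=
  checkR_sound hBL hrt hE₁ hE₂ t [] [] (by simp) List.nodup_nil ht Q hQ hQn (by simp) (by simp)

end Sound

end DiagRPHex

end Summit.QuantumFields.GaugeBoot
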